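import Mathlib
import HarnessLib
import HarnessLib.Audit
import Summits.PneNP.PneNP.Theses.FeasibleWitnessing
import Literature.Computability.MetaComplexity.WitnessingFormulas
import Literature.Computability.MetaComplexity.TextbookFregeCompleteness
import Literature.Computability.Complexity.ClayProblemProofs

/-!
# Line `birth` — BC3 skeleton for the crux `CollapseReachesEF` (stmt-PneNP-17354)

Route `FeasibleWitnessing` (route-PneNP-FeasibleWitnessing), crux (rank 2)
`CollapseReachesEF : ¬ PneNP → ∃ F, IsFrege F ∧ F.IsEFPolyBounded` — "any superpolynomial EF lower bound
separates P and NP" (Pich–Santhanam, Open Problem 1).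

THE LINE = PICH–SANTHANAM'S COROLLARY 20 (2) READ CONTRAPOSITIVELY (J. ACM 73 (2026) 12, §3.2 p. 22 =
arXiv:2312.08163 Cor. 2; doi:10.1145/3801091), cut into its three genuine ingredients over the tree's
encoding-generic witnessing vocabulary (`Literature.Computability.MetaComplexity.WitnessingFormulas`:
`WitnessingFrame`, `W.form n = w^{k,u}_n(f)`, `W.SolvesAt`, `W.SatAdequate`, `PSUniformSelfProvability`):

* `stub_uniformSolverOfCollapse` — THE COLLAPSE, MADE UNIFORM AND CLOCKED (provable now, size M): if
  `NP ⊆ P` (the tree's working classes `Nondeterministic.NP`, `Classes.P`; = `¬ PneNP` through the proved Clay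
  bridges `P_bool_eq_holds` / `NP_bool_eq_holds`, which the composition applies) then for every efficient
  universal machine `U` there are ONE program `e` and ONE exponent `k` such that `U` run on `⟨e, x⟩` for
  `|x|^k` steps outputs a satisfying assignment of every satisfiable CNF code `x` of large length whose
  variables are indexed below `|x|` (search-to-decision `exists_searchFn_of_NP_subset_P` + universality
  `U.sim` + polynomial domination; the index bound repairs the binary-index artefact of `encodingCNF` that
  makes the route's support `SearchSATOfCollapse` summit-equivalent as filed — see `Lines/birth.md`).
* `stub_provableWitnessing` — THE OPEN CORE (Pich–Santhanam Open Problem 1 in the authors' EF reading,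
  p. 7: "imagine p-size EF-proofs of `w^k_n(f)` instead of `S¹₂`-proofs"; for EVERY exponent `k`): for some
  efficient universal machine `U` and every `k` there is a CORRECT witnessing frame `W` (encodings of the
  `n^k`-clocked run of `U`, of a polynomial-time witnessing function `f`, and of `SAT_n`) which is
  SAT-ADEQUATE over `textbookFrege`, HOSTS the `|x|^k`-clocked search-SAT solvers run by `U` (`HostsSolvers`,
  the dictionary between the frame and `U.run (boolPair e x) (|x|^k)` that the assembly consumes), and whose
  witnessing tautologies `W.form n` (`n ≥ n₀`) have extended-Frege proofs of size `poly(n)`.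
* `stub_cor20_2` — PICH–SANTHANAM COR. 20 (2), encoding-generic (printed theorem; = the named fact
  `PSUniformSelfProvability` at `Γ = ∅`, `F = textbookFrege`, i.e. `PSUniformSelfProvability.cor20_2`;
  formalisation size L: substitution of constants into EF proofs, evaluation of closed formulas, renaming
  of extension variables — Cook–Reckhow §4 technology): poly-size EF proofs of the `W.form n` and EF NOT
  p-bounded force every description sequence to fail as a search-SAT algorithm at infinitely many lengths.
* the composition `CollapseReachesEF_of : Sig₁ → Sig₂ → Sig₃ → <crux body verbatim>` — sorry-free classical
  logic plus the two PROVED Clay bridges (`¬ PneNP ⇒ NP ⊆ P`; take `F := textbookFrege`,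
  `isFrege_textbookFrege_holds`; were EF over it not p-bounded, stub 3 on the frame of stub 2 defeats the
  clocked solver of stub 1 transported into the frame by `HostsSolvers`), and THE SKELETON THEOREM
  `CollapseReachesEF_proof : CollapseReachesEF` — the crux BY NAME from the three declared stubs (the file's only
  `sorry`s), the file's only theorem whose head is the crux name (what `ledger skeleton check` keys on).

Disproof used: none exists for this crux (`ledger crux ls stmt-PneNP-17354`: no workfiles, 2026-08-17).
Refuter birth attack (W.lean, 2026-08-17): `IsFrege` conjunct load-bearing (honoured: `textbookFrege`),
`¬C ↔ ¬PneNP ∧ EFLowerBound` (no unconditional kill). Negatives (`ledger negatives --problem PneNP`): none on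
Frege/EF/witnessing; no stub is an instance of a refuted statement. Barriers: Relativization /
Algebrization bite stub 2 only (EF-provability of a white-box statement about `f` is not oracle-invariant —
the escaping hypothesis); NaturalProofs does not apply (uniform conclusion); FeasibleInterpolationEF concerns
the sister crux `EFLowerBound`, not this line.
Planner planner-skel-stmt-PneNP-17354-0, 2026-08-17.
-/

set_option linter.dupNamespace false
set_option linter.unusedVariables false

namespace Summit.PneNP.PneNP.Cruxes.CollapseReachesEF.Birth

open Literature.Computability.Complexity
open Literature.Computability.MetaComplexity
open Summit.PneNP.PneNP.Theses.FeasibleWitnessing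

/-! ## Vocabulary of the line (one transparent definition, no content) -/

/-- `HostsSolvers W U k` — THE FRAME HOSTS THE `|x'|^k`-CLOCKED SEARCH-SAT SOLVERS RUN BY `U` (the dictionary
between the encoding-generic `WitnessingFrame` of `WitnessingFormulas.lean` and the route's working vocabulary
`U.run (boolPair e x') (|x'| ^ k)`, `encodingCNF`). Two clauses. (1) A FIXED RECODING `recode n` (chosen with
the frame, before any program is considered) sends every frame code `x` that is satisfiable in the frame's
sense (`W.sat n x y = true` for some `y`) to a CNF code `x' = recode n x` in G01's `encodingCNF` of length
`≥ n`, coding a satisfiable `φ` whose variables are indexed below `|x'|` (intended: the frame's own `SAT_n` code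
— e.g. the matrix code of `SatMatrixForm.lean`, `codeLen n = 2n²`, for which SAT-adequacy is cheap — rewritten
as a clause list; the index bound is essential: `encodingCNF` writes variable indices in BINARY, so without it
no polynomial-length output could satisfy all satisfiable codes). (2) Every FIXED program `e` — a candidate
search-SAT solver clocked at `|x'| ^ k` steps — is, from some length `N` on, a description `a n` of the frame
(intended: the code of "recode, run `e` through `U`, translate the assignment back", padded into the
`⌊log n⌋ + u(n)` description bits) such that for every frame-satisfiable `x`, IF the output of `U` on
`⟨e, recode n x⟩` within `|recode n x| ^ k` steps satisfies the recoded CNF, THEN the frame's own output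
`W.evalU n (a n, x)` satisfies `x` in the frame's sense (intended: `W.evalU` = the `n ^ O(k)`-clocked run of `U`
on the description and the code). Because the recoding is fixed first, (2) makes the frame at least as strong
a search-SAT solver as every clocked program on the recoded instances — it cannot be met by choosing, per
program, instances on which that program fails. It is exactly what transports a clocked search-SAT solver
`⟨k, e⟩` into a description sequence with `W.SolvesAt a n` at all large `n` (J. ACM p. 22, "Restricting
nonuniformity": the circuit is "a hardwired description of a fixed universal Turing machine" run for `n^k`
steps on a description-plus-advice and the input). A DEFINITION (dictionary predicate with parameters
`W, U, k`), not a statement of the source. [cite: PichSanthanam2026, §3.2 p. 22] -/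
def HostsSolvers (W : WitnessingFrame) (U : UniversalMachine) (k : ℕ) : Prop :=
  ∃ recode : ∀ n, (Fin (W.codeLen n) → Bool) → List Bool,
    (∀ (n : ℕ) (x : Fin (W.codeLen n) → Bool) (y : Fin n → Bool), W.sat n x y = true →
      ∃ φ : CNF ℕ, n ≤ (recode n x).length ∧ encodingCNF.decode (recode n x) = some φ ∧
        φ.numVars ≤ (recode n x).length ∧ φ.Satisfiable) ∧
    ∀ e : List Bool, ∃ (a : ∀ n, Fin (W.descLen n) → Bool) (N : ℕ), ∀ n, N ≤ n →
      ∀ (x : Fin (W.codeLen n) → Bool) (y : Fin n → Bool), W.sat n x y = true →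
        ∀ (φ : CNF ℕ) (z : List Bool), encodingCNF.decode (recode n x) = some φ →
          U.run (boolPair e (recode n x)) ((recode n x).length ^ k) = some z →
            φ.eval (fun i => z.getD i false) = true →
              W.sat n x (W.evalU n (Sum.elim (a n) x)) = true

/-! ## The three registered stubs -/

/-- **Stub 1 — the collapse gives ONE clocked program solving search-SAT** (provable now, size M).
If `NP ⊆ P` (the tree's working classes; this is `¬ PneNP` transported along the proved Clay bridges, which
the composition does) then for every efficient universal machine `U` there are an exponent `k`, a program
`e` and a threshold `N` such that for every CNF code `x` with `|x| ≥ N` coding a satisfiable `φ` WHOSE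
VARIABLES ARE INDEXED BELOW `|x|` (`φ.numVars ≤ |x|` — essential: `encodingCNF` writes indices in binary, so
a code of length `m` may mention the variable `2^m`, which no polynomial-length output assigns; without the
bound the conclusion is unsatisfiable and the stub would collapse to `¬ (NP ⊆ P)`, i.e. to the summit — the
artefact that makes the route's support `SearchSATOfCollapse`, stmt-PneNP-17356, summit-equivalent as filed),
`U` run on `boolPair e x` for `|x| ^ k` steps outputs an assignment satisfying `φ`. Ingredients:
search-to-decision `exists_searchFn_of_NP_subset_P` (Arora–Barak Thm. 2.18) for the `P`-relation
"`decode x = some φ ∧ φ.numVars ≤ |x| ∧ |y| ≤ |x| ∧ y ⊨ φ`" (a polynomial-time CNF evaluator on codes, cf.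
`TautMachine.lean` / `SAT_mem_NP_holds`; `CNF.lt_numVars_of_mem_of_mem` for truncating a satisfying
assignment to `|x|` bits); unpacking `g ∈ FP` into a TM2 machine with a polynomial clock; universality with
polynomial overhead `U.sim`, `U.run_mono`; and `p(q(n)) ≤ n ^ k` for `n ≥ N`.
[cite: AroraBarakCC2009, Thm. 2.18] [cite: PichSanthanam2026, §3.2 p. 22 (Time[n^k]/u(n))] -/
theorem stub_uniformSolverOfCollapse :
    Nondeterministic.NP ⊆ Classes.P → ∀ U : UniversalMachine, ∃ (k : ℕ) (e : List Bool) (N : ℕ),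
      ∀ x : List Bool, N ≤ x.length → ∀ φ : CNF ℕ, encodingCNF.decode x = some φ →
        φ.numVars ≤ x.length → φ.Satisfiable →
          ∃ z : List Bool, U.run (boolPair e x) (x.length ^ k) = some z ∧
            φ.eval (fun i => z.getD i false) = true := by
  sorry

/-- **Stub 2 — PROVABLE UNIFORM WITNESSING FOR EVERY EXPONENT** (OPEN: Pich–Santhanam's Open Problem 1,
"prove that any superpolynomial EF lower bound separates P and NP", via its intended sufficient condition
`S¹₂ ⊢ W^{k}_{n₀}(f)` read — as the authors allow, J. ACM p. 7 — as p-size EF proofs of the witnessing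
tautologies `w^{k,u}_n(f)`; here with the encodings explicit). For some efficient universal machine `U`
and EVERY `k` there are a witnessing frame `W` (the `n^k`-clocked run of `U` on a description and a code,
the run of a polynomial-time witnessing function `f`, the formula `SAT_n`), a threshold `n₀` and a
polynomial `p` with: `W.Correct` (each formula defines its intended map), `W.SatAdequate textbookFrege`
(the last step of the printed proof: refuting `SAT_n(⌜¬ψ⌝, ·)` proves `ψ` cheaply), `HostsSolvers W U k`
(the frame hosts the `|x|^k`-clocked search-SAT solvers run by `U`), and for every `n ≥ n₀` an extended-Frege proof
over `textbookFrege` of `W.form n` of size `≤ p(n)`. Why it might fail: even the TRUTH of same-length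
uniform witnessing is open (J. ACM 12:6); any proof is non-relativizing; `P = NP` may hold only via
algorithms without feasible correctness proofs (then this stub is false while the crux may survive).
[cite: PichSanthanam2026, §1.2 pp. 6–7, §3.2 Cor. 20 (2), §4 Open Problem 1] [cite: PichSanthanam2023, Cor. 2] -/
theorem stub_provableWitnessing :
    ∃ U : UniversalMachine, ∀ k : ℕ,
      ∃ (W : WitnessingFrame) (n₀ : ℕ) (p : Polynomial ℕ),
        W.Correct ∧ W.SatAdequate textbookFrege ∧ HostsSolvers W U k ∧
          ∀ n, n₀ ≤ n → ∃ π : List (PropForm ℕ), textbookFrege.IsEFProofOf π (W.form n) ∧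
            proofSize π ≤ p.eval n := by
  sorry

/-- **Stub 3 — Pich–Santhanam, Corollary 20 (2), encoding-generic, over `textbookFrege`** (printed theorem;
the named fact `PSUniformSelfProvability` of `WitnessingFormulas.lean` at `Γ = ∅`, `F = textbookFrege` —
once that fact is discharged this stub is `PSUniformSelfProvability.cor20_2 h isFrege_textbookFrege_holds`;
formalisation size L: substitute the bits of a correct description-plus-advice `a n` into the EF proof of
`w^{k,u}_n(f)`, refute the right disjunct by evaluating the closed run formulas, and conclude p-boundedness
of EF from SAT-adequacy). For every correct, `textbookFrege`-adequate frame whose witnessing formulas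
`W.form n`, `n ≥ n₀`, have EF proofs of size `poly(n)`: if EF over `textbookFrege` is NOT polynomially
bounded, then every description-plus-advice sequence `a` fails to solve search-SAT (in the frame's sense,
`W.SolvesAt a n`) at infinitely many lengths `n`.
[cite: PichSanthanam2026, §3.2 Cor. 20 (2) p. 22 (with the proof of Thm. 19)] [cite: CookReckhow1979, §4] -/
theorem stub_cor20_2 :
    ∀ W : WitnessingFrame, W.Correct → W.SatAdequate textbookFrege → ∀ n₀ : ℕ,
      (∃ p : Polynomial ℕ, ∀ n, n₀ ≤ n →
        ∃ π : List (PropForm ℕ), textbookFrege.IsEFProofOf π (W.form n) ∧ proofSize π ≤ p.eval n) →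
      ¬ textbookFrege.IsEFPolyBounded →
        ∀ (a : ∀ n, Fin (W.descLen n) → Bool) (N : ℕ), ∃ n, N ≤ n ∧ ¬ W.SolvesAt a n := by
  sorry

/-! ## The composition (sorry-free) and the skeleton theorem -/

/-- **THE COMPOSITION** `Sig₁ → Sig₂ → Sig₃ → crux`: the hypotheses are the three stub signatures VERBATIM and the
conclusion is the crux's body VERBATIM (`¬ PneNP → ∃ F, IsFrege F ∧ F.IsEFPolyBounded`, definitionally
`CollapseReachesEF`), so that `CollapseReachesEF_proof` below is the file's ONLY theorem whose head is the crux name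
— what `ledger skeleton check` keys on (its layer invariant admits as hypotheses only registered obligations by
name). Classical logic: assume `¬ PneNP`, whence `NP ⊆ P` over the working classes by the proved bridges
`P_bool_eq_holds`, `NP_bool_eq_holds`; exhibit `F := textbookFrege` (`isFrege_textbookFrege_holds`); were EF over
it not p-bounded, take the universal machine `U` of stub 2, the clocked solver `⟨k, e, N₁⟩` of stub 1 for this
`U`, the frame `W` of stub 2 at this `k` with its fixed recoding, and the description sequence `a` hosting `e` in
`W` (`HostsSolvers`); stub 3 yields a length `n ≥ max N₁ N₂` at which `a` does not solve search-SAT in the frame,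
whereas the dictionary `HostsSolvers` + the solver property of `e` (at the recoded CNF code `recode n x`, of length
`≥ n ≥ N₁`, variables indexed below its length) show that it does — contradiction.
[cite: PichSanthanam2026, §3.2 Cor. 20 (2) p. 22] -/
theorem CollapseReachesEF_of
    (h₁ : Nondeterministic.NP ⊆ Classes.P → ∀ U : UniversalMachine, ∃ (k : ℕ) (e : List Bool) (N : ℕ),
      ∀ x : List Bool, N ≤ x.length → ∀ φ : CNF ℕ, encodingCNF.decode x = some φ →
        φ.numVars ≤ x.length → φ.Satisfiable →
          ∃ z : List Bool, U.run (boolPair e x) (x.length ^ k) = some z ∧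
            φ.eval (fun i => z.getD i false) = true)
    (h₂ : ∃ U : UniversalMachine, ∀ k : ℕ,
      ∃ (W : WitnessingFrame) (n₀ : ℕ) (p : Polynomial ℕ),
        W.Correct ∧ W.SatAdequate textbookFrege ∧ HostsSolvers W U k ∧
          ∀ n, n₀ ≤ n → ∃ π : List (PropForm ℕ), textbookFrege.IsEFProofOf π (W.form n) ∧
            proofSize π ≤ p.eval n)
    (h₃ : ∀ W : WitnessingFrame, W.Correct → W.SatAdequate textbookFrege → ∀ n₀ : ℕ,
      (∃ p : Polynomial ℕ, ∀ n, n₀ ≤ n →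
        ∃ π : List (PropForm ℕ), textbookFrege.IsEFProofOf π (W.form n) ∧ proofSize π ≤ p.eval n) →
      ¬ textbookFrege.IsEFPolyBounded →
        ∀ (a : ∀ n, Fin (W.descLen n) → Bool) (N : ℕ), ∃ n, N ≤ n ∧ ¬ W.SolvesAt a n) :
    ¬ PneNP → ∃ F : Literature.Computability.MetaComplexity.FregeSystem,
      Literature.Computability.MetaComplexity.IsFrege F ∧ F.IsEFPolyBounded := by
  intro hS
  -- the proved Clay bridges: `¬ PneNP` puts certificate-`NP` inside `P` over the working classes
  have hNP : Nondeterministic.NP ⊆ Classes.P := by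
    intro L hL
    have hP : PNPWave0.P Bool = Classes.P := P_bool_eq_holds
    have hN : PNPWave0.NP Bool = Nondeterministic.NP := NP_bool_eq_holds
    have hLP : L ∈ PNPWave0.P Bool := by
      by_contra hL'
      exact hS ⟨L, hN ▸ hL, hL'⟩
    exact hP ▸ hLP
  refine ⟨textbookFrege, isFrege_textbookFrege_holds, ?_⟩
  by_contra hEF
  obtain ⟨U, hU⟩ := h₂
  obtain ⟨k, e, N₁, hsolve⟩ := h₁ hNP U
  obtain ⟨W, n₀, p, hW, hA, ⟨recode, hrec, hhost⟩, hproofs⟩ := hU k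
  obtain ⟨a, N₂, ha⟩ := hhost e
  obtain ⟨n, hn, hfail⟩ := h₃ W hW hA n₀ ⟨p, hproofs⟩ hEF a (max N₁ N₂)
  apply hfail
  intro x y hxy
  obtain ⟨φ, hlen, hdec, hvars, hsat⟩ := hrec n x y hxy
  obtain ⟨z, hz, hzφ⟩ := hsolve (recode n x) ((le_of_max_le_left hn).trans hlen) φ hdec hvars hsat
  exact ha n (le_of_max_le_right hn) x y hxy φ z hdec hz hzφ

/-- **THE SKELETON THEOREM.** The crux `Summit.PneNP.PneNP.Theses.FeasibleWitnessing.CollapseReachesEF`, concluded BY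
NAME from the three DECLARED stubs `stub_uniformSolverOfCollapse`, `stub_provableWitnessing`, `stub_cor20_2` (the
file's only `sorry`s) through the sorry-free composition `CollapseReachesEF_of`.
[cite: PichSanthanam2026, §3.2 Cor. 20 (2) p. 22] -/
theorem CollapseReachesEF_proof : CollapseReachesEF :=
  CollapseReachesEF_of stub_uniformSolverOfCollapse stub_provableWitnessing stub_cor20_2

end Summit.PneNP.PneNP.Cruxes.CollapseReachesEF.Birth
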